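import Literature.MathematicalPhysics.QuantumFieldTheory.QCDFlavourSymmetry
import Literature.MathematicalPhysics.QuantumLattice.GrassmannParity
import Mathlib.LinearAlgebra.CliffordAlgebra.Conjugation
import Mathlib.LinearAlgebra.CliffordAlgebra.Prod
import HarnessLib

/-!
# Crux `TorusHalfSpectrum` (stmt-QuantumFields-9508), line `registered` (`Lines/birth.lean`, reshape v4) —
# stub `stub_homogeneous_supercommute`: torus placements of flavour-homogeneous observables supercommute

Stub G of the birth skeleton of the crux
`Summit.QuantumFields.QCD.Theses.QuarksNoInfraredClause.TorusHalfSpectrum` (= `SupercommuteStmt`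
unfolded): if the gauge-invariant local lattice-QCD observables `A`, `B` are HOMOGENEOUS of charges
`q_A, q_B ∈ ℤ^{N_f}` under the vector flavour torus — `flavourScale t (A.F U) = (∏_f t_f^{q_{A,f}}) • A.F U`
for all `t ∈ (ℂˣ)^{N_f}` (`ψ_f ↦ t_f ψ_f`, `ψ̄_f ↦ t_f⁻¹ ψ̄_f`) — then their torus placements
`A.onTorus S u U`, `B.onTorus S v U` (elements of the torus quark Grassmann algebra `FermiAlg N_f S`)
satisfy the graded commutation rule
`A(u) B(v) = (−1)^{|∑_f q_{A,f}| |∑_f q_{B,f}|} B(v) A(u)`: no support or disjointness condition is needed,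
a Grassmann (exterior) algebra being supercommutative.  This is the regrouping of Euclidean 4-point
functions between the "time grouping" and the "space grouping" in the light core of the crux.

Proof:

* PARITY FROM HOMOGENEITY.  At `t ≡ −1` every generator weight is `−1` (`(−1)⁻¹ = −1`), so
  `flavourScale (−1)` is Mathlib's grade involution `CliffordAlgebra.involute` of the boxed Grassmann
  algebra (`flavourScale_neg_one`), while the character is `∏_f (−1)^{q_f} = (−1)^{∑_f q_f}`
  (`prod_neg_one_zpow`).  In any Clifford algebra over a field of characteristic zero, an element with
  `involute x = x` is even and one with `involute x = −x` is odd (`mem_evenOdd_zero_of_involute_eq`,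
  `mem_evenOdd_one_of_involute_eq_neg`: decompose `x = x₀ + x₁` along `CliffordAlgebra.evenOdd_isCompl`,
  `involute x = x₀ − x₁` by `involute_eq_of_mem_even/odd`, and cancel a factor `2`).  Hence
  `A.F U ∈ evenOdd ((∑_f q_{A,f}) mod 2)` (`mem_evenOdd_of_homogeneous`).
* SUPERCOMMUTATIVITY.  `onTorus` is `ExteriorAlgebra.map` of a linear map of generator coefficients,
  i.e. `CliffordAlgebra.map` of an isometry of ZERO quadratic forms, for which every pair of vectors is
  orthogonal (`QuadraticMap.IsOrtho.all`); Mathlib's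
  `CliffordAlgebra.map_mul_map_of_isOrtho_of_mem_evenOdd` then gives
  `map f₁ x * map f₂ y = (−1)^{ij} • (map f₂ y * map f₁ x)` for `x ∈ evenOdd i`, `y ∈ evenOdd j`
  (`map_mul_map_of_mem_evenOdd`, with the sign rewritten as `(−1 : K)^{|m n|}` for integer labels).

Everything used is proved in the tree / Mathlib (no named fact).  Sources: F. A. Berezin, *The Method of
Second Quantization* (1966), Ch. I §3 (Grassmann algebra, parity); I. Montvay, G. Münster, *Quantum
Fields on a Lattice* (CUP 1994), §5.1.1 (5.6) (vector flavour symmetry); K. Osterwalder, E. Seiler,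
Ann. Phys. 110 (1978) 440, §2 (the algebra of gauge-invariant local lattice observables).
-/

noncomputable section

namespace Summit.QuantumFields.QCD.Cruxes.TorusHalfSpectrum.Birth.Supercommute

open scoped BigOperators
open Literature.MathematicalPhysics.QuantumFieldTheory Literature.MathematicalPhysics.QuantumLattice
  Literature.Probability.LatticeModels

/-! ### Parity from the grade involution (generic Clifford algebra over a field of characteristic zero) -/

section Involute

variable {K : Type*} [Field K] [CharZero K] {M : Type*} [AddCommGroup M] [Module K M]
  (Q : QuadraticForm K M)

omit [CharZero K] in
/-- Every element of a Clifford algebra is the sum of an even and an odd element. -/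
theorem exists_even_add_odd (x : CliffordAlgebra Q) :
    ∃ x₀ ∈ CliffordAlgebra.evenOdd Q 0, ∃ x₁ ∈ CliffordAlgebra.evenOdd Q 1, x₀ + x₁ = x :=
  Submodule.mem_sup.1 ((CliffordAlgebra.evenOdd_isCompl Q).sup_eq_top.symm ▸ Submodule.mem_top)

/-- **A fixed point of the grade involution is even** (characteristic zero). -/
theorem mem_evenOdd_zero_of_involute_eq {x : CliffordAlgebra Q} (h : CliffordAlgebra.involute x = x) :
    x ∈ CliffordAlgebra.evenOdd Q 0 := by
  obtain ⟨x₀, hx₀, x₁, hx₁, rfl⟩ := exists_even_add_odd Q x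
  rw [map_add, CliffordAlgebra.involute_eq_of_mem_even hx₀, CliffordAlgebra.involute_eq_of_mem_odd hx₁,
    add_right_inj] at h
  have hx₁0 : x₁ = 0 := by
    have h2 : (2 : K) • x₁ = 0 := by
      rw [two_smul]
      nth_rewrite 1 [← h]
      exact neg_add_cancel x₁
    exact (smul_eq_zero.1 h2).resolve_left two_ne_zero
  rw [hx₁0, add_zero]
  exact hx₀

/-- **An element negated by the grade involution is odd** (characteristic zero). -/
theorem mem_evenOdd_one_of_involute_eq_neg {x : CliffordAlgebra Q} (h : CliffordAlgebra.involute x = -x) :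
    x ∈ CliffordAlgebra.evenOdd Q 1 := by
  obtain ⟨x₀, hx₀, x₁, hx₁, rfl⟩ := exists_even_add_odd Q x
  rw [map_add, CliffordAlgebra.involute_eq_of_mem_even hx₀, CliffordAlgebra.involute_eq_of_mem_odd hx₁,
    neg_add, add_left_inj] at h
  have hx₀0 : x₀ = 0 := by
    have h2 : (2 : K) • x₀ = 0 := by
      rw [two_smul]
      nth_rewrite 2 [h]
      exact add_neg_cancel x₀
    exact (smul_eq_zero.1 h2).resolve_left two_ne_zero
  rw [hx₀0, zero_add]
  exact hx₁

/-- An element on which the grade involution acts by `(−1)^n`, `n ∈ ℤ`, has parity `n mod 2`. -/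
theorem mem_evenOdd_of_involute_eq_smul {x : CliffordAlgebra Q} {n : ℤ}
    (h : CliffordAlgebra.involute x = ((-1 : K) ^ n) • x) :
    x ∈ CliffordAlgebra.evenOdd Q (n : ZMod 2) := by
  rcases Int.even_or_odd n with hn | hn
  · rw [hn.neg_one_zpow, one_smul] at h
    rw [ZMod.intCast_eq_zero_iff_even.2 hn]
    exact mem_evenOdd_zero_of_involute_eq Q h
  · rw [hn.neg_one_zpow, neg_one_smul] at h
    rw [ZMod.intCast_eq_one_iff_odd.2 hn]
    exact mem_evenOdd_one_of_involute_eq_neg Q h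

end Involute

/-! ### Supercommutativity of a Grassmann algebra -/

/-- **Homogeneous elements of a Grassmann algebra supercommute**, in the form needed for torus
placements: for substitutions of generators `f₁`, `f₂` into a common Grassmann algebra and `x` of
parity `m mod 2`, `y` of parity `n mod 2`,
`Λ(f₁) x · Λ(f₂) y = (−1)^{|m n|} Λ(f₂) y · Λ(f₁) x` (Mathlib's
`CliffordAlgebra.map_mul_map_of_isOrtho_of_mem_evenOdd` for zero quadratic forms, where all vectors
are orthogonal). -/
theorem map_mul_map_of_mem_evenOdd {K : Type*} [CommRing K] {ι₁ ι₂ κ : Type*}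
    (f₁ : (ι₁ → K) →ₗ[K] (κ → K)) (f₂ : (ι₂ → K) →ₗ[K] (κ → K)) {m n : ℤ}
    {x : GrassmannAlgebra K ι₁} {y : GrassmannAlgebra K ι₂}
    (hx : x ∈ GrassmannAlgebra.evenOdd K (m : ZMod 2)) (hy : y ∈ GrassmannAlgebra.evenOdd K (n : ZMod 2)) :
    ExteriorAlgebra.map f₁ x * ExteriorAlgebra.map f₂ y =
      ((-1 : K) ^ (m * n).natAbs) • (ExteriorAlgebra.map f₂ y * ExteriorAlgebra.map f₁ x) := by
  let g₁ : (0 : QuadraticForm K (ι₁ → K)) →qᵢ (0 : QuadraticForm K (κ → K)) :=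
    { f₁ with map_app' := fun _ => rfl }
  let g₂ : (0 : QuadraticForm K (ι₂ → K)) →qᵢ (0 : QuadraticForm K (κ → K)) :=
    { f₂ with map_app' := fun _ => rfl }
  have h := CliffordAlgebra.map_mul_map_of_isOrtho_of_mem_evenOdd g₁ g₂
    (fun _ _ => QuadraticMap.IsOrtho.all _ _) x y hx hy
  have e₁ : ExteriorAlgebra.map f₁ = CliffordAlgebra.map g₁ := rfl
  have e₂ : ExteriorAlgebra.map f₂ = CliffordAlgebra.map g₂ := rfl
  rw [e₁, e₂, h, ← Int.cast_mul]
  rcases Int.even_or_odd (m * n) with hmn | hmn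
  · rw [ZMod.intCast_eq_zero_iff_even.2 (mul_comm m n ▸ hmn), uzpow_zero, one_smul,
      (Int.natAbs_even.2 hmn).neg_one_pow, one_smul]
  · rw [ZMod.intCast_eq_one_iff_odd.2 (mul_comm m n ▸ hmn), uzpow_one, Units.neg_smul, one_smul,
      (Int.natAbs_odd.2 hmn).neg_one_pow, neg_one_smul]

/-! ### Parity of a flavour-homogeneous observable -/

variable {Nf R : ℕ}

/-- `∏_a (−1)^{q_a} = (−1)^{∑_a q_a}` for integer exponents. -/
theorem prod_neg_one_zpow {α : Type*} (s : Finset α) (q : α → ℤ) :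
    ∏ a ∈ s, (-1 : ℂ) ^ q a = (-1 : ℂ) ^ ∑ a ∈ s, q a := by
  classical
  induction s using Finset.induction_on with
  | empty => simp
  | insert a s ha ih =>
    rw [Finset.prod_insert ha, Finset.sum_insert ha, ih, zpow_add₀ (neg_ne_zero.2 one_ne_zero)]

/-- At `t ≡ −1` every flavour weight is `−1` (`(−1)⁻¹ = −1` on `ψ̄`, `−1` on `ψ`). -/
theorem flavourWeight_neg_one (w : BoxFermiIdx Nf R ⊕ₗ BoxFermiIdx Nf R) :
    QCDLatticeObservable.flavourWeight (fun _ : Fin Nf => (-1 : ℂ)) w = -1 := by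
  induction w using lex_sum_ind with
  | hl a => rw [QCDLatticeObservable.flavourWeight_inl, inv_neg_one]
  | hr b => rw [QCDLatticeObservable.flavourWeight_inr]

/-- **The flavour torus element `t ≡ −1` acts as the grade (parity) involution** of the boxed quark
Grassmann algebra: `−1` on every generator. -/
theorem flavourScale_neg_one :
    QCDLatticeObservable.flavourScale (R := R) (fun _ : Fin Nf => (-1 : ℂ)) = CliffordAlgebra.involute := by
  refine ExteriorAlgebra.hom_ext (LinearMap.ext fun v => ?_)
  have hv : (LinearMap.pi fun w => QCDLatticeObservable.flavourWeight (fun _ : Fin Nf => (-1 : ℂ)) w •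
      (LinearMap.proj w : (BoxFermiIdx Nf R ⊕ₗ BoxFermiIdx Nf R → ℂ) →ₗ[ℂ] ℂ)) v = -v := by
    funext w
    simp only [LinearMap.pi_apply, LinearMap.smul_apply, LinearMap.proj_apply, flavourWeight_neg_one,
      smul_eq_mul, Pi.neg_apply, neg_one_mul]
  rw [LinearMap.comp_apply, LinearMap.comp_apply, AlgHom.toLinearMap_apply, AlgHom.toLinearMap_apply,
    QCDLatticeObservable.flavourScale_eq, ExteriorAlgebra.map_apply_ι, hv, map_neg,
    CliffordAlgebra.involute_ι]

/-- **A flavour-homogeneous observable of charge `q` has Grassmann parity `(∑_f q_f) mod 2`**: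
homogeneity at `t ≡ −1` reads `involute (A.F U) = (−1)^{∑_f q_f} • A.F U`. -/
theorem mem_evenOdd_of_homogeneous {A : QCDLatticeObservable Nf R} {q : Fin Nf → ℤ}
    (hA : ∀ t : Fin Nf → ℂ, (∀ f, t f ≠ 0) → ∀ U,
      QCDLatticeObservable.flavourScale t (A.F U) = (∏ f, t f ^ (q f)) • A.F U)
    (U : LGConfig 4 (Matrix.specialUnitaryGroup (Fin 3) ℂ)) :
    A.F U ∈ GrassmannAlgebra.evenOdd ℂ ((∑ f, q f : ℤ) : ZMod 2) := by
  have h := hA (fun _ => -1) (fun _ => neg_ne_zero.2 one_ne_zero) U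
  rw [flavourScale_neg_one, prod_neg_one_zpow] at h
  exact mem_evenOdd_of_involute_eq_smul _ h

/-! ### The stub -/

/-- **Stub G: graded commutativity of torus placements of flavour-homogeneous observables.**  If `A`
(charge `q_A`) and `B` (charge `q_B`) are homogeneous under the vector flavour torus, then on every
torus, at all placements `u, v` and in every gauge background,
`A(u) · B(v) = (−1)^{|(∑_f q_{A,f}) (∑_f q_{B,f})|} B(v) · A(u)` in the torus quark Grassmann algebra. -/
theorem stub_homogeneous_supercommute :
    ∀ (Nf R R' : ℕ) (A : QCDLatticeObservable Nf R) (B : QCDLatticeObservable Nf R') (qA qB : Fin Nf → ℤ),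
      (∀ t : Fin Nf → ℂ, (∀ f, t f ≠ 0) → ∀ U,
          QCDLatticeObservable.flavourScale t (A.F U) = (∏ f, t f ^ (qA f)) • A.F U) →
      (∀ t : Fin Nf → ℂ, (∀ f, t f ≠ 0) → ∀ U,
          QCDLatticeObservable.flavourScale t (B.F U) = (∏ f, t f ^ (qB f)) • B.F U) →
      ∀ (S : ℕ) [NeZero S] (u v : _root_.Literature.Probability.LatticeModels.Site 4)
        (U : GaugeConfig 4 S (Matrix.specialUnitaryGroup (Fin 3) ℂ)),
        A.onTorus S u U * B.onTorus S v U =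
          ((-1 : ℂ) ^ ((∑ f, qA f) * (∑ f, qB f)).natAbs) • (B.onTorus S v U * A.onTorus S u U) := by
  intro Nf R R' A B qA qB hA hB S _ u v U
  unfold QCDLatticeObservable.onTorus
  exact map_mul_map_of_mem_evenOdd _ _ (mem_evenOdd_of_homogeneous hA _) (mem_evenOdd_of_homogeneous hB _)

end Summit.QuantumFields.QCD.Cruxes.TorusHalfSpectrum.Birth.Supercommute

end
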